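import Summits.QuantumAdvantage.QuantumAdvantage.Theorems.CubicForrelationNearExactIsExactFlatRadical
import Summits.QuantumAdvantage.QuantumAdvantage.Theorems.CubicForrelationNearExactIsExactFourierPeriods

/-!
# Crux `CubicForrelation.NearExactIsExact` (stmt-QuantumAdvantage-14043) — the `L¹` Fourier bound for a sign pattern that is quadratic
  of rank `≤ 2` along a flat (general `n`), and small coset tools

Certificate seat `b2b-cforr-cert` (gen 6).  HONEST FRAMING: infrastructure about `±1` patterns on cosets of `𝔽₂ⁿ` (the engine of the two-sided
analysis of the boundary value `Φ = 31/32` on 16 bits) — NOT summit progress.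

* `fl1_flat_l1` (**the engine**): `S = x₁ ⊕ V₀` a coset (`V₀ ∋ 0` `⊕`-closed), `e = ±1` on `S`; if every parametrised 3-flat sum of `e`
  inside `S` is `≡ 0 (mod 4)` and every parametrised 4-flat sum inside `S` is `≡ 0 (mod 8)`, then the transform of `A = e·1_S` satisfies
  `(Σ_y |Â(y)|)² ≤ 4·4ⁿ`, i.e. `Σ_y |Â(y)| ≤ 2^{n+1}` — for ANY dimension of the flat.  (`…FlatRadical`: the radical `R` of the relative
  form has `4·#R ≥ #V₀` and consists of periods up to sign; `…FourierPeriods`: `(Σ|Â|)²·#R ≤ 4ⁿ·#S`.)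
* tools: `fl1_avoid` / `fl1_dirs2` (directions inside a set `U` avoiding translates of a smaller `V₀`: two directions `t₁, t₂ ∈ U` with
  `t₁, t₂, t₁ ⊕ t₂ ∉ V₀` as soon as `2·#V₀ < #U`), coset membership helpers `fl1_coset_*`, `fl1_pairing` (`Σ_y (−1)^{g(y)} Â(y) = Σ_x A(x) W_g(x)`),
  `fl1_W_smul`.

References: R. O'Donnell (2014) §3.3; MacWilliams–Sloane (1977) Ch. 15 §2.  Everything below is proved from Mathlib and the tree; axioms are
the standard three.
-/

set_option linter.dupNamespace false -- D-0017: single-problem summit ⇒ `QuantumAdvantage.QuantumAdvantage` by design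

noncomputable section

namespace Summit.QuantumAdvantage.QuantumAdvantage.Theorems.CubicForrelation.NearExactIsExact

open Finset
open Literature.Computability.QuantumComplexity
open Literature.Computability.QuantumComplexity.BuzetChailloux (bxor zeroVec bxor_bxor_cancel_left bxor_zeroVec zeroVec_bxor bxor_comm
  bxor_self)
open Literature.Computability.QuantumComplexity.DerivativeWalsh (W)

variable {n : ℕ}

/-! ### Directions avoiding translates -/

/-- A vector of `U` outside at most `ts.length` translates of `V₀`, when `ts.length·#V₀ < #U`. [folklore] -/
theorem fl1_avoid (U V₀ : Finset (Fin n → Bool)) (ts : List (Fin n → Bool)) (hts : ts.length * #V₀ < #U) :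
    ∃ d ∈ U, ∀ t ∈ ts, bxor t d ∉ V₀ := by
  classical
  have hU : #(ts.toFinset.biUnion fun t => V₀.image (bxor t)) < #U := by
    calc #(ts.toFinset.biUnion fun t => V₀.image (bxor t)) ≤ ∑ t ∈ ts.toFinset, #(V₀.image (bxor t)) := card_biUnion_le
      _ ≤ ∑ t ∈ ts.toFinset, #V₀ := sum_le_sum fun t _ => card_image_le
      _ = #ts.toFinset * #V₀ := by rw [sum_const, smul_eq_mul]
      _ ≤ ts.length * #V₀ := Nat.mul_le_mul_right _ (List.toFinset_card_le ts)
      _ < #U := hts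
  obtain ⟨d, hdU, hd⟩ := exists_mem_notMem_of_card_lt_card hU
  refine ⟨d, hdU, fun t ht hmem => hd ?_⟩
  rw [mem_biUnion]
  exact ⟨t, List.mem_toFinset.2 ht, mem_image.2 ⟨bxor t d, hmem, bxor_bxor_cancel_left t d⟩⟩

/-- **Two transversal directions inside `U`.** If `2·#V₀ < #U` there are `t₁, t₂ ∈ U` with `t₁, t₂, t₁ ⊕ t₂, t₂ ⊕ t₁ ∉ V₀`. [folklore] -/
theorem fl1_dirs2 (U V₀ : Finset (Fin n → Bool)) (hcard : 2 * #V₀ < #U) :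
    ∃ t₁ ∈ U, ∃ t₂ ∈ U, t₁ ∉ V₀ ∧ t₂ ∉ V₀ ∧ bxor t₁ t₂ ∉ V₀ ∧ bxor t₂ t₁ ∉ V₀ := by
  have hz : ∀ d : Fin n → Bool, bxor zeroVec d = d := zeroVec_bxor
  obtain ⟨t₁, ht₁U, ht₁⟩ := fl1_avoid U V₀ [zeroVec] (by simp only [List.length_singleton]; omega)
  have e₁ : t₁ ∉ V₀ := by simpa only [hz] using ht₁ zeroVec (by simp)
  obtain ⟨t₂, ht₂U, ht₂⟩ := fl1_avoid U V₀ [zeroVec, t₁] (by simp only [List.length_cons, List.length_nil]; omega)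
  have e₂ : t₂ ∉ V₀ := by simpa only [hz] using ht₂ zeroVec (by simp)
  have e₁₂ : bxor t₁ t₂ ∉ V₀ := ht₂ t₁ (by simp)
  exact ⟨t₁, ht₁U, t₂, ht₂U, e₁, e₂, e₁₂, by rw [bxor_comm]; exact e₁₂⟩

/-! ### Coset membership helpers (`S = x₁ ⊕ V₀`) -/

section Coset

variable {V₀ S : Finset (Fin n → Bool)} {x₁ : Fin n → Bool}

/-- `x ∈ S`, `a ∈ V₀` ⇒ `x ⊕ a ∈ S`. [folklore] -/
theorem fl1_coset_vadd (hadd : ∀ a ∈ V₀, ∀ b ∈ V₀, bxor a b ∈ V₀) (hS : S = V₀.image (bxor x₁)) {x a : Fin n → Bool}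
    (hx : x ∈ S) (ha : a ∈ V₀) : bxor x a ∈ S := by
  have key := fl_coset_translate V₀ S x₁ hadd hS hx ha zeroVec
  rw [bxor_zeroVec] at key
  -- `key : bxor x a ∈ S ↔ 0 ∈ V₀`; we avoid needing `0 ∈ V₀` by the direct image description
  rw [hS, mem_image] at hx ⊢
  obtain ⟨c, hc, rfl⟩ := hx
  exact ⟨bxor c a, hadd _ hc _ ha, (iw_bxor_assoc _ _ _).symm⟩

/-- `x ∈ S` ⇒ `x₁ ⊕ x ∈ V₀`. [folklore] -/
theorem fl1_coset_diff (hS : S = V₀.image (bxor x₁)) {x : Fin n → Bool} (hx : x ∈ S) : bxor x₁ x ∈ V₀ := by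
  rw [hS, mem_image] at hx
  obtain ⟨c, hc, rfl⟩ := hx
  rwa [bxor_bxor_cancel_left]

/-- `x ∈ S`, `t ∉ V₀` ⇒ `x ⊕ t ∉ S`. [folklore] -/
theorem fl1_coset_out (h0 : zeroVec ∈ V₀) (hadd : ∀ a ∈ V₀, ∀ b ∈ V₀, bxor a b ∈ V₀) (hS : S = V₀.image (bxor x₁))
    {x t : Fin n → Bool} (hx : x ∈ S) (ht : t ∉ V₀) : bxor x t ∉ S := by
  have key := fl_coset_translate V₀ S x₁ hadd hS hx h0 t
  rw [bxor_zeroVec] at key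
  exact fun hmem => ht (key.1 hmem)

/-- `x ∉ S`, `a ∈ V₀` ⇒ `x ⊕ a ∉ S`. [folklore] -/
theorem fl1_coset_out' (hadd : ∀ a ∈ V₀, ∀ b ∈ V₀, bxor a b ∈ V₀) (hS : S = V₀.image (bxor x₁))
    {x a : Fin n → Bool} (hx : x ∉ S) (ha : a ∈ V₀) : bxor x a ∉ S := by
  intro hmem
  have := fl1_coset_vadd hadd hS hmem ha
  rw [iw_bxor_assoc, bxor_self, bxor_zeroVec] at this
  exact hx this

end Coset

/-! ### Small analytic tools -/

/-- Linearity of the transform in a scalar. [folklore] -/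
theorem fl1_W_smul (c : ℝ) (A : (Fin n → Bool) → ℝ) (y : Fin n → Bool) : W (fun x => c * A x) y = c * W A y := by
  unfold W
  rw [mul_sum]
  exact sum_congr rfl fun x _ => by ring

/-- **Pairing identity.** `Σ_y (−1)^{g(y)} Â(y) = Σ_x A(x) W_g(x)`. [cite: ODonnell2014, §3.3] -/
theorem fl1_pairing (g : (Fin n → Bool) → Bool) (A : (Fin n → Bool) → ℝ) :
    ∑ y, signOf (g y) * W A y = ∑ x, A x * W (fun y => signOf (g y)) x := by
  unfold W
  simp_rw [mul_sum]
  rw [sum_comm]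
  refine sum_congr rfl fun x _ => sum_congr rfl fun y _ => ?_
  rw [twist_comm x y]
  ring

/-- The pairing is dominated by the `L¹` norm. [folklore] -/
theorem fl1_pairing_le_l1 (g : (Fin n → Bool) → Bool) (T : (Fin n → Bool) → ℝ) :
    ∑ y, signOf (g y) * T y ≤ ∑ y, |T y| :=
  sum_le_sum fun y _ => by
    calc signOf (g y) * T y ≤ |signOf (g y) * T y| := le_abs_self _
      _ = |T y| := by rw [abs_mul]; unfold signOf; split_ifs <;> norm_num

/-- A `±1` integer is the sign of the bit `[e = −1]`. [folklore] -/
theorem fl1_sZ_decide {e : ℤ} (he : e = 1 ∨ e = -1) : e = sZ (decide (e = -1)) := by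
  rcases he with h | h <;> rw [h] <;> decide

/-! ### The engine: `L¹` bound for a rank-`≤ 2` sign pattern on a coset -/

/-- **`Σ_y |Â(y)| ≤ 2^{n+1}` for `A = e·1_S`** when `e = ±1` on the coset `S = x₁ ⊕ V₀` has all parametrised 3-flat sums inside `S`
`≡ 0 (mod 4)` and all parametrised 4-flat sums inside `S` `≡ 0 (mod 8)` (directions in `V₀`; stated as `(Σ_y |Â(y)|)² ≤ 4·2ⁿ·2ⁿ`).
Independent of the dimension of the flat. [this work] -/
theorem fl1_flat_l1 (V₀ S : Finset (Fin n → Bool)) (x₁ : Fin n → Bool) (h0 : zeroVec ∈ V₀)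
    (hadd : ∀ a ∈ V₀, ∀ b ∈ V₀, bxor a b ∈ V₀) (hS : S = V₀.image (bxor x₁)) (e : (Fin n → Bool) → ℤ)
    (he : ∀ x ∈ S, e x = 1 ∨ e x = -1)
    (H3 : ∀ x ∈ S, ∀ a b c : Fin n → Bool, a ∈ V₀ → b ∈ V₀ → c ∈ V₀ →
      (4 : ℤ) ∣ ∑ ε : Fin 3 → Bool, e (fun j => x j ^^ decide (Odd #(univ.filter fun i =>
        ε i && (![a, b, c] : Fin 3 → Fin n → Bool) i j))))
    (H4 : ∀ x ∈ S, ∀ a₀ a₁ a₂ a₃ : Fin n → Bool, a₀ ∈ V₀ → a₁ ∈ V₀ → a₂ ∈ V₀ → a₃ ∈ V₀ →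
      (8 : ℤ) ∣ ∑ ε : Fin 4 → Bool, e (fun j => x j ^^ decide (Odd #(univ.filter fun i =>
        ε i && (![a₀, a₁, a₂, a₃] : Fin 4 → Fin n → Bool) i j)))) :
    (∑ y, |W (fun x => if x ∈ S then (e x : ℝ) else 0) y|) ^ 2 ≤ 4 * (2 : ℝ) ^ n * 2 ^ n := by
  classical
  have hx₁ : x₁ ∈ S := by rw [hS]; exact mem_image.2 ⟨zeroVec, h0, bxor_zeroVec x₁⟩
  set h : (Fin n → Bool) → Bool := fun x => decide (e x = -1) with hh
  have heh : ∀ x ∈ S, e x = sZ (h x) := fun x hx => fl1_sZ_decide (he x hx)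
  have hPV : ∀ x, x ∈ S → ∀ a ∈ V₀, bxor x a ∈ S := fun x hx a ha => fl1_coset_vadd hadd hS hx ha
  have hVP : ∀ x, x ∈ S → bxor x₁ x ∈ V₀ := fun x hx => fl1_coset_diff hS hx
  -- the hypotheses in sign form
  have H3' : ∀ x, x ∈ S → ∀ a b c : Fin n → Bool, a ∈ V₀ → b ∈ V₀ → c ∈ V₀ →
      (4 : ℤ) ∣ ∑ ε : Fin 3 → Bool, sZ (h (fun j => x j ^^ decide (Odd #(univ.filter fun i =>
        ε i && (![a, b, c] : Fin 3 → Fin n → Bool) i j)))) := by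
    intro x hx a b c ha hb hc
    have key := H3 x hx a b c ha hb hc
    rwa [sum_congr rfl fun ε _ => heh _ (fr_mem_flatPt3 V₀ h0 (· ∈ S) hPV hx ![a, b, c]
      (fun i => by fin_cases i <;> assumption) ε)] at key
  have H4' : ∀ x, x ∈ S → ∀ a₀ a₁ a₂ a₃ : Fin n → Bool, a₀ ∈ V₀ → a₁ ∈ V₀ → a₂ ∈ V₀ → a₃ ∈ V₀ →
      (8 : ℤ) ∣ ∑ ε : Fin 4 → Bool, sZ (h (fun j => x j ^^ decide (Odd #(univ.filter fun i =>
        ε i && (![a₀, a₁, a₂, a₃] : Fin 4 → Fin n → Bool) i j)))) := by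
    intro x hx a₀ a₁ a₂ a₃ ha₀ ha₁ ha₂ ha₃
    have key := H4 x hx a₀ a₁ a₂ a₃ ha₀ ha₁ ha₂ ha₃
    rwa [sum_congr rfl fun ε _ => heh _ (fr_mem_flatPt4 V₀ h0 (· ∈ S) hPV hx ![a₀, a₁, a₂, a₃]
      (fun i => by fin_cases i <;> assumption) ε)] at key
  -- the radical
  set R := V₀.filter (fun a => ∀ b ∈ V₀, (h x₁ ^^ h (bxor x₁ a) ^^ h (bxor x₁ b) ^^ h (bxor (bxor x₁ a) b)) = false) with hR
  have hsd := fr_hsd V₀ (· ∈ S) x₁ hx₁ hVP h H3'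
  have hlarge : #V₀ ≤ 4 * #R := fr_radical_large V₀ (· ∈ S) x₁ h hadd hx₁ hPV hVP H3' H4'
  have hR0 : zeroVec ∈ R := fr_radical_zero_mem V₀ x₁ h h0
  have hRadd : ∀ a ∈ R, ∀ b ∈ R, bxor a b ∈ R := fr_radical_add V₀ (· ∈ S) x₁ h hx₁ hPV hadd hsd
  -- periods up to sign of `A = e·1_S`
  set A : (Fin n → Bool) → ℝ := fun x => if x ∈ S then (e x : ℝ) else 0 with hA
  have hA1 : ∀ x ∈ S, A x = 1 ∨ A x = -1 := by
    intro x hx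
    simp only [A, if_pos hx]
    rcases he x hx with h1 | h1 <;> rw [h1] <;> norm_num
  have hA0 : ∀ x, x ∉ S → A x = 0 := fun x hx => by simp only [A, if_neg hx]
  have hper : ∀ a ∈ R, ∃ c : ℝ, (c = 1 ∨ c = -1) ∧ ∀ x, A (bxor x a) = c * A x := by
    intro a ha
    have haV : a ∈ V₀ := (mem_filter.1 ha).1
    refine ⟨((sZ (h x₁ ^^ h (bxor x₁ a)) : ℤ) : ℝ), ?_, fun x => ?_⟩
    · rcases tp_sZ_cases (h x₁ ^^ h (bxor x₁ a)) with hc | hc <;> rw [hc] <;> norm_num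
    · by_cases hx : x ∈ S
      · have hxa : bxor x a ∈ S := hPV x hx a haV
        simp only [A, if_pos hx, if_pos hxa]
        rw [heh _ hxa, heh _ hx, fr_radical_period V₀ (· ∈ S) x₁ h hx₁ hVP hsd ha hx]
        rw [tp_sZ_cast, tp_sZ_cast, tp_sZ_cast, signOf_xor]
        ring
      · have hxa : bxor x a ∉ S := fl1_coset_out' hadd hS hx haV
        simp only [A, if_neg hx, if_neg hxa, mul_zero]
  -- Fourier bound and counting
  have hF := fp_l1_sq_mul_le A S R hA1 hA0 hR0 hRadd hper
  have hScard : #S = #V₀ := by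
    rw [hS, card_image_of_injective _ fun a b hab => by simpa only [bxor_bxor_cancel_left] using congrArg (bxor x₁) hab]
  have hRpos : (0 : ℝ) < #R := by
    have : 0 < #R := card_pos.2 ⟨zeroVec, hR0⟩
    exact_mod_cast this
  have hle : ((#V₀ : ℕ) : ℝ) ≤ 4 * #R := by exact_mod_cast hlarge
  rw [hScard] at hF
  by_contra hcon
  push Not at hcon
  have h1 : (∑ y, |W A y|) ^ 2 * #R ≤ (2 : ℝ) ^ n * 2 ^ n * (4 * #R) :=
    hF.trans (mul_le_mul_of_nonneg_left hle (by positivity))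
  nlinarith

end Summit.QuantumAdvantage.QuantumAdvantage.Theorems.CubicForrelation.NearExactIsExact

end
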